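import Summits.Parity.GeneralizedHardyLittlewood.Theses.LiouvilleMAD
import Literature.NumberTheory.LFunctions.DirichletPolyBilinearMVT
import Literature.NumberTheory.LFunctions.DirichletMVTSharp

/-!
# Sketch (crux-ideate r2, ideator 5) — crux stmt-Parity-13318 `FanDecorrelation`, idea `mellin-height-law`

First-lemma candidates and the transfer statement of the idea card
`Cruxes/FanDecorrelation/Ideas/mellin-height-law.md`.  Nothing here is proved except the
read-back `fanDecorrelation_iff`; the `def … : Prop` items are STATEMENTS (the card's
`First lemma:` is `MellinPlancherel`, an exact identity; `HeightLaw` is the transfer target C⁺;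
`Transfer` is the claim C⁺ → crux, glue by a dyadic partition of the sharp lag window).
-/

noncomputable section

open scoped BigOperators ContDiff
open Complex MeasureTheory Finset

namespace Summit.Parity.GeneralizedHardyLittlewood.Cruxes.FanDecorrelation.SketchIdeator5

open Summit.Parity.GeneralizedHardyLittlewood.Theses.LiouvilleMAD

/-- `λ` at an integer argument (`0` at nonpositive arguments), as in the route file. -/
def L (z : ℤ) : ℝ := (ArithmeticFunction.liouville (Int.toNat z) : ℝ)

/-- Lag correlation `D(h) = Σ_{(m,m') ∈ (M,2M]², m − m' = h} λ(mn+c) λ(m'n'+c)`. -/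
def lagCorr (c : ℤ) (n n' M : ℕ) (h : ℤ) : ℝ :=
  ∑ p ∈ (Ioc M (2 * M) ×ˢ Ioc M (2 * M)).filter (fun p : ℕ × ℕ => (p.1 : ℤ) - p.2 = h),
    L ((p.1 : ℤ) * n + c) * L ((p.2 : ℤ) * n' + c)

/-- The crux's fan sum `R_k = Σ_{j ∈ [Q,2Q)} D(kj)`, `Q = ⌊√M⌋ + 1`. -/
def fanSum (c : ℤ) (n n' M : ℕ) (k : ℤ) : ℝ :=
  ∑ j ∈ Ico (Nat.sqrt M + 1) (2 * (Nat.sqrt M + 1)), lagCorr c n n' M (k * j)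

/-- READ-BACK: the crux is `|R_k| ≤ C·M^{3/4+ϑ}` for some `ϑ < 1/4` (definitional). -/
theorem fanDecorrelation_iff :
    FanDecorrelation ↔ ∀ c : ℤ, c ≠ 0 → ∃ ϑ : ℝ, ϑ < 1 / 4 ∧ ∃ C : ℝ, ∀ M n n' : ℕ, ∀ k : ℤ,
      1 ≤ n → 1 ≤ n' → n ≠ n' → n ≤ 2 * M → n' ≤ 2 * M → k ≠ 0 →
        |fanSum c n n' M k| ≤ C * (M : ℝ) ^ (3 / 4 + ϑ) :=
  Iff.rfl

/-! ## The transfer target C⁺ = `HeightLaw` (smooth lag windows of every width `D ≥ 1`) -/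

/-- Smooth-window fan: the lags `h = kj` weighted by `φ((j − P)/D)` instead of `1_{[Q,2Q)}(j)`. -/
def smoothFan (φ : ℝ → ℝ) (P D : ℝ) (c : ℤ) (n n' M : ℕ) (k : ℤ) : ℝ :=
  ∑ j ∈ Icc 1 (2 * M), φ (((j : ℝ) - P) / D) * lagCorr c n n' M (k * j)

/-- **HeightLaw** (C⁺ of the card).  For every smooth bump `φ` supported in `[-2,2]` and every
`c ≠ 0` there are `ϑ < 1/4` and `C` with `|Σ_j φ((j−P)/D)·D(kj)| ≤ C·M^{3/4+ϑ}` for all `M`, all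
dilations `1 ≤ n ≠ n' ≤ 2M`, all `k ≠ 0`, every WIDTH `1 ≤ D ≤ Q/8` and every CENTRE
`Q ≤ P ≤ 2Q` (`Q = ⌊√M⌋+1`; since `supp φ ⊆ [-2,2]` every lag used is `kj` with
`j ∈ [3Q/4, 9Q/4]` — no lag `0`, no proportional lag once `M > 2c²`).  Width `D ≍ Q` = pure
second-order content (Mellin height `√M/k`); width `D = 1` = pointwise dilated two-point sums
(13319-class).  No instance is the sharp crux (fixed `φ`, `M`-independent). -/
def HeightLaw : Prop :=
  ∀ φ : ℝ → ℝ, ContDiff ℝ ∞ φ → (∀ x : ℝ, φ x ≠ 0 → |x| ≤ 2) →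
    ∀ c : ℤ, c ≠ 0 → ∃ ϑ : ℝ, ϑ < 1 / 4 ∧ ∃ C : ℝ, ∀ M n n' : ℕ, ∀ k : ℤ, ∀ P D : ℝ,
      1 ≤ n → 1 ≤ n' → n ≠ n' → n ≤ 2 * M → n' ≤ 2 * M → k ≠ 0 →
        1 ≤ D → 8 * D ≤ ((Nat.sqrt M : ℝ) + 1) →
          ((Nat.sqrt M : ℝ) + 1) ≤ P → P ≤ 2 * ((Nat.sqrt M : ℝ) + 1) →
            |smoothFan φ P D c n n' M k| ≤ C * (M : ℝ) ^ (3 / 4 + ϑ)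

/-- The card's transfer claim `C⁺ → crux` (glue: `1_{[Q,2Q)}` on the integers is a sum of
`≤ 2·log₂ Q + 12` pieces `φ_i((j − P_i)/D_i)` with `1 ≤ D_i ≤ Q/8`, `P_i ∈ [Q,2Q]`, drawn from
FOUR fixed bumps — interior partition of unity at width `Q/8`, left/right dyadic edge layers,
single-lag end caps — so `|R_k| ≤ (2 log₂ Q + 12)·C·M^{3/4+ϑ'} ≤ C'·M^{3/4+ϑ}` for any `ϑ > ϑ'`;
`M ≤ 2c²` or `Q < 8` is absorbed in `C'`). -/
def Transfer : Prop := HeightLaw → FanDecorrelation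

/-- The `D = 1` end of `HeightLaw`, spelled out: pointwise power saving for the dilated two-point
sums with UNEQUAL shifts `Σ_{m' ∈ (M, 2M−h]} λ((m'+h)n + c) λ(m'n' + c)` at a single lag
`|h| ≥ Q/2` (normal form: `±Σ_u λ(u)λ(u+w)` along `u ≡ n'c (mod nn')`,
`w = c(n−n') − nn'h ≠ 0`) — the class of the route's rank-4 crux `DilatedChowla` (13319). -/
def TwoShiftDilatedChowla : Prop :=
  ∀ c : ℤ, c ≠ 0 → ∃ κ : ℝ, 0 < κ ∧ ∃ C : ℝ, ∀ M n n' : ℕ, ∀ h : ℤ,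
    1 ≤ n → 1 ≤ n' → n ≠ n' → n ≤ 2 * M → n' ≤ 2 * M →
      ((Nat.sqrt M : ℤ) + 1) ≤ 2 * |h| → |h| ≤ 4 * M →
        |lagCorr c n n' M h| ≤ C * (M : ℝ) ^ (1 - κ)

/-! ## First lemma: the Mellin-side Plancherel identity (exact) -/

/-- `logKernel K u = ∫ K(t) e^{−itu} dt` — the kernel on multiplicative lags `u = ω_y − ω_{y'}`. -/
def logKernel (K : ℝ → ℂ) (u : ℝ) : ℂ := ∫ t : ℝ, K t * Complex.exp (-(((t * u : ℝ) : ℂ) * I))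

/-- Generalised Dirichlet polynomial `Σ_{y ∈ s} a_y e^{−itω_y}` (`freq y = log(y + θ)` in the line). -/
def dirPoly (s : Finset ℕ) (freq : ℕ → ℝ) (a : ℕ → ℂ) (t : ℝ) : ℂ :=
  ∑ y ∈ s, a y * Complex.exp (-(((t * freq y : ℝ) : ℂ) * I))

/-- **First lemma (`MellinPlancherel`).**  For an integrable kernel `K`, finitely many real
frequencies `freq y` and coefficients `a, b`:
`∫ K(t)·X_a(t)·conj(X_b(t)) dt = Σ_{y,y'} a_y conj(b_{y'}) · logKernel K (ω_y − ω_{y'})`.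
(Finite sum ↔ integral interchange; with `a_y = λ(kny + rn + c)`, `b = λ(kn'y' + rn' + c)`,
`ω_y = log(y + (rn+c)/(kn))` and `logKernel K` supported on the multiplicative lag window this IS
the smooth fan, class by class, summed inside the integral.) -/
def MellinPlancherel : Prop :=
  ∀ (s : Finset ℕ) (freq : ℕ → ℝ) (a b : ℕ → ℂ) (K : ℝ → ℂ), Integrable K →
    ∫ t : ℝ, K t * dirPoly s freq a t * (starRingEnd ℂ) (dirPoly s freq b t) =
      ∑ y ∈ s, ∑ y' ∈ s, a y * (starRingEnd ℂ) (b y') * logKernel K (freq y - freq y')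

/-- **Height localisation (statement).**  Heights `|t| ≥ W` cost at most the Montgomery–Vaughan
off-diagonal: for coefficients supported on `[1, N]` and `4 ≤ W`,
`∫_{Y−W}^{Y+W} |Σ a_n n^{−it}|² ≤ Σ (5W + 65n)|a_n|²` is the tree's PROVED
`Literature.NumberTheory.LFunctions.DirichletMVT.meanSquare_shift_le_sharp`; the polarised form with the
diagonal subtracted is `Literature.NumberTheory.LFunctions.norm_integral_dirichletPoly_mul_conj_sub_le`.
Recorded here only as the instance the line uses (no new content). -/
theorem heightLocalisation_input (a : ℕ → ℂ) (N : ℕ) {W : ℝ} (hW : 4 ≤ W) (Y : ℝ) :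
    ∫ t in (Y - W)..(Y + W), ‖∑ n ∈ Finset.Icc 1 N, a n * (n : ℂ) ^ (-((t : ℂ) * I))‖ ^ 2 ≤
      ∑ n ∈ Finset.Icc 1 N, (5 * W + 65 * n) * ‖a n‖ ^ 2 :=
  Literature.NumberTheory.LFunctions.DirichletMVT.meanSquare_shift_le_sharp a N hW Y

end Summit.Parity.GeneralizedHardyLittlewood.Cruxes.FanDecorrelation.SketchIdeator5
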